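/-
Copyright (c) 2026. All rights reserved.
Released under Apache 2.0 license as described in the file LICENSE.
-/
import Literature.Geometry.Kaehler.ComplexTorusQuaternionAtkinLehnerThree
import HarnessLib

/-!
# Six pairwise `Γ`-inequivalent CM points on `Z(1)` and on `Z(6)` of Lang's `(−1,3)` curve: the three points of
# g29-#3 and their Atkin–Lehner translates `w₃(·)` (g29-#6) — separated by the mod-`2` invariant across classes and by
# the norm-`−1` obstruction (KRY Lemma 3.4.3) inside each class
# (Kudla–Rapoport–Yang 2006 §3.4 (3.4.13)–(3.4.14), Lemma 3.4.3, Remark 3.4.7; Ogg 1983 §2; Lang 1982 IX §5 Thm. 5.1)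

[tag: complex_torus] [tag: abelian_surface] [tag: quaternion_multiplication] [tag: complex_multiplication]
[tag: shimura_curve] [tag: special_cycles] [tag: atkin_lehner] [tag: quaternion_order]

Lane `lit-hodgefound`, seat p12, row g29-#7 — THEOREMS ONLY (no definition, no named fact, no instance); the tally row of
the gen-29 series (g29-#3 mod-`2` invariant, g29-#4 classes, g29-#5 `w₂ = ρ(1 + i)`, g29-#6 `w₃ = ρ(3 + j + ij)` and the
norm-`−1` obstruction). Setting: Lang's family `A(τ) = ℂ²/ρ(𝔬)(τ, 1)ᵗ`, `(a, b) = (−1, 3)`, `𝔬 = ℤ⟨1, i, j, ij⟩`,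
`IsRhoIsomorphic` = isomorphism of QM surfaces (Lang IX Thm. 5.1 / KRY Prop. 3.2.1), CM points `z_x ∈ 𝔥` of special
vectors `x ∈ L(t)` (KRY (3.4.8)–(3.4.9)), `Z(t)(ℂ) = Σ_{x ∈ L(t) mod Γ} pr(D_x)` (3.4.13), «the computation of
`deg Z(t)_ℚ` is reduced to a counting problem» (3.4.14).

## The print, VERBATIM

* S. Kudla, M. Rapoport, T. Yang (2006) [KudlaRapoportYang2006] §3.4 (3.4.13) «`Z(t)(ℂ) = Σ_{x ∈ L(t) mod Γ} pr(D_x)`»,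
  (3.4.14) «so that the computation of `deg Z(t)_ℚ` is reduced to a counting problem», Lemma 3.4.3 «(i) `−x ∉ Γ·x`.
  (ii) … `z̄₀ ∉ Γ·z₀`», Remark 3.4.7 («the group of Atkin–Lehner involutions permutes the components transitively»);
  §3.2 Prop. 3.2.1.
* A. P. Ogg (1983) [Ogg1983RealPoints] §2 p. 283 (the Atkin–Lehner involutions `w(m)`, `m ∥ D`).
* S. Lang (1982) [Lang1982AbelianFunctions] Ch. IX §5 Thm. 5.1.

## What is proved

* §1 the remaining transports: `μ(2i + ij)μ̄ = 3(4i + 2j − ij)`, `μ(3i + ij)μ̄ = 3(9i + 4j − 3ij)`, `μ(6i + j + 3ij)μ̄ =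
  3(18i + 9j − 5ij)`, so `ρ(4i + 2j − ij)` fixes `w₃(τ_k)`, `ρ(9i + 4j − 3ij)` fixes `w₃(i√(2 − √3))`, `ρ(18i + 9j − 5ij)`
  fixes `w₃(τ₆″)`; the norm-`−1` units `ε₁ = −2 − i − j − ij`, `ε₂ = −1 − i − j` with `ε₁(2i + ij)ε̄₁ = 4i + 2j − ij`,
  `ε₂(3i + ij)ε̄₂ = 9i + 4j − 3ij`, `ε₁(6i + j + 3ij)ε̄₁ = 18i + 9j − 5ij`, hence `(A(τ_k), ρ) ≇ (A(w₃τ_k), ρ)`,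
  `(A(i√(2−√3)), ρ) ≇ (A(w₃ i√(2−√3)), ρ)`, `(A(τ₆″), ρ) ≇ (A(w₃τ₆″), ρ)`.
* §2 **`Z(1)`: the six CM points `i`, `τ_h = (√3 + i)/2`, `τ_k = (2 − √3)i`, `w₃(i)`, `w₃(τ_h)`, `w₃(τ_k)` (special vectors
  `i, 2i + j, 2i + ij, 5i + 2j − 2ij, 16i + 7j − 6ij, 4i + 2j − ij ∈ L(1)`) are PAIRWISE `Γ`-inequivalent** — 15
  non-isomorphisms of QM surfaces (`zOne_six_points`).
* §3 **`Z(6)`: the six CM points `τ₆`, `i√(2 − √3)`, `τ₆″`, `w₃(τ₆)`, `w₃(i√(2−√3))`, `w₃(τ₆″)` (special vectors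
  `3i + j, 3i + ij, 6i + j + 3ij, 21i + 9j − 8ij, 9i + 4j − 3ij, 18i + 9j − 5ij ∈ L(6)`) are PAIRWISE `Γ`-inequivalent**
  (`zSix_six_points`). So `#(L(1)/±Γ) ≥ 6` and `#(L(6)/±Γ) ≥ 6` for Lang's order.

## Honest scope

Lower bounds only: no claim that these exhaust `Z(1)` or `Z(6)`, no value of `deg Z(t)`, no identification of the
abelian surfaces `A(w₃z)` (the three of g29-#3 are `C_i²` resp. `(ℂ/ℤ[√−6])²`). 0 definitions, 0 named facts,
0 instances — net debt `0`.

## References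
* [KudlaRapoportYang2006] S. Kudla, M. Rapoport, T. Yang, *Modular Forms and Special Cycles on Shimura Curves*, Ann. of
  Math. Stud. 161 (2006), §3.2 Prop. 3.2.1; §3.4 (3.4.8)–(3.4.14), Lemma 3.4.3, Remark 3.4.7.
* [Ogg1983RealPoints] A. P. Ogg, *Real points on Shimura curves*, Progr. Math. 35 (1983), §2 p. 283.
* [Lang1982AbelianFunctions] S. Lang, *Introduction to Algebraic and Abelian Functions*, 2nd ed. (1982), Ch. IX §5, Thm. 5.1.
-/

noncomputable section

set_option maxSynthPendingDepth 3

open Complex Module Matrix Quaternion Function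
open scoped ComplexConjugate

namespace Literature.Geometry.Kaehler.ComplexTorus.QuaternionType

/-! ## §1 The remaining transports `w₃(τ_k)`, `w₃(i√(2 − √3))`, `w₃(τ₆″)` and their norm-`−1` obstructions -/

section Transports

/-- `4i + 2j − ij, 9i + 4j − 3ij, 18i + 9j − 5ij` have norms `1, 6, 6`. [cite: KudlaRapoportYang2006, §3.4 (3.4.8)] -/
theorem norm_w3_vectors :
    ((⟨0, 4, 2, -1⟩ : ℍ[ℚ,((-1 : ℤ) : ℚ),((3 : ℤ) : ℚ)]) * star ⟨0, 4, 2, -1⟩).re = 1 ∧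
    ((⟨0, 9, 4, -3⟩ : ℍ[ℚ,((-1 : ℤ) : ℚ),((3 : ℤ) : ℚ)]) * star ⟨0, 9, 4, -3⟩).re = 6 ∧
    ((⟨0, 18, 9, -5⟩ : ℍ[ℚ,((-1 : ℤ) : ℚ),((3 : ℤ) : ℚ)]) * star ⟨0, 18, 9, -5⟩).re = 6 := by
  refine ⟨?_, ?_, ?_⟩ <;> rw [QuaternionAlgebra.star_mk, QuaternionAlgebra.mk_mul_mk] <;> norm_num

/-- `5i + 2j − 2ij, 16i + 7j − 6ij, 21i + 9j − 8ij, 9i + 4j − 3ij ∈ 𝔬`. [cite: Lang1982AbelianFunctions, Ch. IX §4] -/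
theorem mem_order_w3_vectors :
    (⟨0, 5, 2, -2⟩ : ℍ[ℚ,((-1 : ℤ) : ℚ),((3 : ℤ) : ℚ)]) ∈ order (-1) 3 ∧ (⟨0, 16, 7, -6⟩ : ℍ[ℚ,((-1 : ℤ) : ℚ),((3 : ℤ) : ℚ)]) ∈ order (-1) 3 ∧
    (⟨0, 21, 9, -8⟩ : ℍ[ℚ,((-1 : ℤ) : ℚ),((3 : ℤ) : ℚ)]) ∈ order (-1) 3 ∧ (⟨0, 9, 4, -3⟩ : ℍ[ℚ,((-1 : ℤ) : ℚ),((3 : ℤ) : ℚ)]) ∈ order (-1) 3 :=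
  ⟨⟨![0, 5, 2, -2], by ext <;> simp [ofCoords]⟩, ⟨![0, 16, 7, -6], by ext <;> simp [ofCoords]⟩,
    ⟨![0, 21, 9, -8], by ext <;> simp [ofCoords]⟩, ⟨![0, 9, 4, -3], by ext <;> simp [ofCoords]⟩⟩

/-- **`μ(2i + ij)μ̄ = 3(4i + 2j − ij)`, `μ(3i + ij)μ̄ = 3(9i + 4j − 3ij)`, `μ(6i + j + 3ij)μ̄ = 3(18i + 9j − 5ij)`**
(`μ = 3 + j + ij`). [cite: Ogg1983RealPoints, §2 p. 283] [cite: Lang1982AbelianFunctions, Ch. IX §4] -/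
theorem three_add_j_add_ij_conj_examples :
    (⟨3, 0, 1, 1⟩ : ℍ[ℚ,((-1 : ℤ) : ℚ),((3 : ℤ) : ℚ)]) * ⟨0, 2, 0, 1⟩ * star ⟨3, 0, 1, 1⟩ = (3 : ℚ) • ⟨0, 4, 2, -1⟩ ∧
    (⟨3, 0, 1, 1⟩ : ℍ[ℚ,((-1 : ℤ) : ℚ),((3 : ℤ) : ℚ)]) * ⟨0, 3, 0, 1⟩ * star ⟨3, 0, 1, 1⟩ = (3 : ℚ) • ⟨0, 9, 4, -3⟩ ∧
    (⟨3, 0, 1, 1⟩ : ℍ[ℚ,((-1 : ℤ) : ℚ),((3 : ℤ) : ℚ)]) * ⟨0, 6, 1, 3⟩ * star ⟨3, 0, 1, 1⟩ = (3 : ℚ) • ⟨0, 18, 9, -5⟩ := by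
  refine ⟨?_, ?_, ?_⟩ <;>
    rw [QuaternionAlgebra.star_mk, QuaternionAlgebra.mk_mul_mk, QuaternionAlgebra.mk_mul_mk, QuaternionAlgebra.smul_mk] <;>
    ext <;> norm_num

/-- **The norm-`−1` units `ε₁ = −2 − i − j − ij`, `ε₂ = −1 − i − j`**: `ε₁ε̄₁ = ε₂ε̄₂ = −1`, both in `𝔬`.
[cite: Lang1982AbelianFunctions, Ch. IX §5 (first paragraph)] [cite: Ogg1983RealPoints, §1] -/
theorem norm_neg_one_units :
    (⟨-2, -1, -1, -1⟩ : ℍ[ℚ,((-1 : ℤ) : ℚ),((3 : ℤ) : ℚ)]) * star ⟨-2, -1, -1, -1⟩ = -1 ∧ (⟨-1, -1, -1, 0⟩ : ℍ[ℚ,((-1 : ℤ) : ℚ),((3 : ℤ) : ℚ)]) * star ⟨-1, -1, -1, 0⟩ = -1 ∧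
    (⟨-2, -1, -1, -1⟩ : ℍ[ℚ,((-1 : ℤ) : ℚ),((3 : ℤ) : ℚ)]) ∈ order (-1) 3 ∧ (⟨-1, -1, -1, 0⟩ : ℍ[ℚ,((-1 : ℤ) : ℚ),((3 : ℤ) : ℚ)]) ∈ order (-1) 3 := by
  refine ⟨?_, ?_, ⟨![-2, -1, -1, -1], by ext <;> simp [ofCoords]⟩, ⟨![-1, -1, -1, 0], by ext <;> simp [ofCoords]⟩⟩ <;>
    rw [QuaternionAlgebra.star_mk, QuaternionAlgebra.mk_mul_mk] <;> ext <;> norm_num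

/-- **`ε₁(2i + ij)ε̄₁ = 4i + 2j − ij`, `ε₂(3i + ij)ε̄₂ = 9i + 4j − 3ij`, `ε₁(6i + j + 3ij)ε̄₁ = 18i + 9j − 5ij`** — the
`Ad(μ)`-images are norm-`−1` conjugates. [cite: KudlaRapoportYang2006, §3.4 Lemma 3.4.3] [cite: Lang1982AbelianFunctions, Ch. IX §4] -/
theorem norm_neg_one_conj_examples :
    (⟨-2, -1, -1, -1⟩ : ℍ[ℚ,((-1 : ℤ) : ℚ),((3 : ℤ) : ℚ)]) * ⟨0, 2, 0, 1⟩ * star ⟨-2, -1, -1, -1⟩ = ⟨0, 4, 2, -1⟩ ∧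
    (⟨-1, -1, -1, 0⟩ : ℍ[ℚ,((-1 : ℤ) : ℚ),((3 : ℤ) : ℚ)]) * ⟨0, 3, 0, 1⟩ * star ⟨-1, -1, -1, 0⟩ = ⟨0, 9, 4, -3⟩ ∧
    (⟨-2, -1, -1, -1⟩ : ℍ[ℚ,((-1 : ℤ) : ℚ),((3 : ℤ) : ℚ)]) * ⟨0, 6, 1, 3⟩ * star ⟨-2, -1, -1, -1⟩ = ⟨0, 18, 9, -5⟩ := by
  refine ⟨?_, ?_, ?_⟩ <;>
    rw [QuaternionAlgebra.star_mk, QuaternionAlgebra.mk_mul_mk, QuaternionAlgebra.mk_mul_mk] <;> ext <;> norm_num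

/-- `Im w₃(τ_k) > 0`. [cite: Lang1982AbelianFunctions, Ch. IX §5 (3)] -/
theorem im_w3_tauK_pos : 0 < (moebius (rho (-1) 3 (by norm_num) (castQ (-1) 3 (⟨3, 0, 1, 1⟩ : ℍ[ℚ,((-1 : ℤ) : ℚ),((3 : ℤ) : ℚ)]))) ⟨0, 2 - Real.sqrt 3⟩).im :=
  im_w3_coe_pos ⟨⟨0, 2 - Real.sqrt 3⟩, tauK_im_pos⟩

/-- `Im i√(2 − √3) > 0`. [cite: KudlaRapoportYang2006, §3.4 (3.4.9)] -/
theorem im_axis_pos : 0 < ((((Real.sqrt (2 - Real.sqrt 3) : ℝ) : ℂ) * I)).im := by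
  simpa using sqrt_two_sub_sqrt_three_pos

/-- `Im w₃(i√(2 − √3)) > 0`. [cite: Lang1982AbelianFunctions, Ch. IX §5 (3)] -/
theorem im_w3_axis_pos : 0 < (moebius (rho (-1) 3 (by norm_num) (castQ (-1) 3 (⟨3, 0, 1, 1⟩ : ℍ[ℚ,((-1 : ℤ) : ℚ),((3 : ℤ) : ℚ)]))) (((Real.sqrt (2 - Real.sqrt 3) : ℝ) : ℂ) * I)).im :=
  im_w3_coe_pos ⟨(((Real.sqrt (2 - Real.sqrt 3) : ℝ) : ℂ) * I), im_axis_pos⟩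

/-- `Im τ₆″ > 0`. [cite: KudlaRapoportYang2006, §3.4 (3.4.9)] -/
theorem tauSixBis_im_pos : 0 < ((⟨Real.sqrt 3 / (6 + 3 * Real.sqrt 3), Real.sqrt 6 / (6 + 3 * Real.sqrt 3)⟩ : ℂ)).im :=
  div_pos (Real.sqrt_pos.2 (by norm_num)) (by positivity)

/-- `Im w₃(τ₆″) > 0`. [cite: Lang1982AbelianFunctions, Ch. IX §5 (3)] -/
theorem im_w3_tauSixBis_pos : 0 < (moebius (rho (-1) 3 (by norm_num) (castQ (-1) 3 (⟨3, 0, 1, 1⟩ : ℍ[ℚ,((-1 : ℤ) : ℚ),((3 : ℤ) : ℚ)]))) ⟨Real.sqrt 3 / (6 + 3 * Real.sqrt 3), Real.sqrt 6 / (6 + 3 * Real.sqrt 3)⟩).im :=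
  im_w3_coe_pos ⟨⟨Real.sqrt 3 / (6 + 3 * Real.sqrt 3), Real.sqrt 6 / (6 + 3 * Real.sqrt 3)⟩, tauSixBis_im_pos⟩

/-- `ρ(4i + 2j − ij)` fixes `w₃(τ_k)`. [cite: KudlaRapoportYang2006, §3.4 (3.4.9), (3.4.13)] -/
theorem moebius_rho_w3_tauK :
    moebius (rho (-1) 3 (by norm_num) (castQ (-1) 3 (⟨0, 4, 2, -1⟩ : ℍ[ℚ,((-1 : ℤ) : ℚ),((3 : ℤ) : ℚ)]))) (moebius (rho (-1) 3 (by norm_num) (castQ (-1) 3 (⟨3, 0, 1, 1⟩ : ℍ[ℚ,((-1 : ℤ) : ℚ),((3 : ℤ) : ℚ)]))) ⟨0, 2 - Real.sqrt 3⟩) = moebius (rho (-1) 3 (by norm_num) (castQ (-1) 3 (⟨3, 0, 1, 1⟩ : ℍ[ℚ,((-1 : ℤ) : ℚ),((3 : ℤ) : ℚ)]))) ⟨0, 2 - Real.sqrt 3⟩ :=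
  moebius_rho_fixed_of_three_add_j_add_ij_conj three_add_j_add_ij_conj_examples.1 ⟨⟨0, 2 - Real.sqrt 3⟩, tauK_im_pos⟩
    moebius_rho_tauK

/-- `ρ(9i + 4j − 3ij)` fixes `w₃(i√(2 − √3))`. [cite: KudlaRapoportYang2006, §3.4 (3.4.9), (3.4.13)] -/
theorem moebius_rho_w3_axis :
    moebius (rho (-1) 3 (by norm_num) (castQ (-1) 3 (⟨0, 9, 4, -3⟩ : ℍ[ℚ,((-1 : ℤ) : ℚ),((3 : ℤ) : ℚ)]))) (moebius (rho (-1) 3 (by norm_num) (castQ (-1) 3 (⟨3, 0, 1, 1⟩ : ℍ[ℚ,((-1 : ℤ) : ℚ),((3 : ℤ) : ℚ)]))) (((Real.sqrt (2 - Real.sqrt 3) : ℝ) : ℂ) * I)) = moebius (rho (-1) 3 (by norm_num) (castQ (-1) 3 (⟨3, 0, 1, 1⟩ : ℍ[ℚ,((-1 : ℤ) : ℚ),((3 : ℤ) : ℚ)]))) (((Real.sqrt (2 - Real.sqrt 3) : ℝ) : ℂ) * I) :=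
  moebius_rho_fixed_of_three_add_j_add_ij_conj three_add_j_add_ij_conj_examples.2.1 ⟨(((Real.sqrt (2 - Real.sqrt 3) : ℝ) : ℂ) * I), im_axis_pos⟩
    moebius_rho_three_i_add_ij_axis

/-- `ρ(18i + 9j − 5ij)` fixes `w₃(τ₆″)`. [cite: KudlaRapoportYang2006, §3.4 (3.4.9), (3.4.13)] -/
theorem moebius_rho_w3_tauSixBis :
    moebius (rho (-1) 3 (by norm_num) (castQ (-1) 3 (⟨0, 18, 9, -5⟩ : ℍ[ℚ,((-1 : ℤ) : ℚ),((3 : ℤ) : ℚ)]))) (moebius (rho (-1) 3 (by norm_num) (castQ (-1) 3 (⟨3, 0, 1, 1⟩ : ℍ[ℚ,((-1 : ℤ) : ℚ),((3 : ℤ) : ℚ)]))) ⟨Real.sqrt 3 / (6 + 3 * Real.sqrt 3), Real.sqrt 6 / (6 + 3 * Real.sqrt 3)⟩) = moebius (rho (-1) 3 (by norm_num) (castQ (-1) 3 (⟨3, 0, 1, 1⟩ : ℍ[ℚ,((-1 : ℤ) : ℚ),((3 : ℤ) : ℚ)]))) ⟨Real.sqrt 3 / (6 + 3 * Real.sqrt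 3), Real.sqrt 6 / (6 + 3 * Real.sqrt 3)⟩ :=
  moebius_rho_fixed_of_three_add_j_add_ij_conj three_add_j_add_ij_conj_examples.2.2 ⟨⟨Real.sqrt 3 / (6 + 3 * Real.sqrt 3), Real.sqrt 6 / (6 + 3 * Real.sqrt 3)⟩, tauSixBis_im_pos⟩
    moebius_rho_tauSixBis

/-- **`(A(τ_k), ρ) ≇ (A(w₃τ_k), ρ)`** (norm-`−1` obstruction with `ε₁`). [cite: KudlaRapoportYang2006, §3.4 Lemma 3.4.3 and §3.2 Prop. 3.2.1] [cite: Lang1982AbelianFunctions, Ch. IX §5 Thm. 5.1] -/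
theorem not_isRhoIsomorphic_tauK_w3 : ¬ IsRhoIsomorphic (a := -1) (b := 3) (by norm_num) (by norm_num) tauK_im_ne_zero im_w3_tauK_pos.ne' :=
  not_isRhoIsomorphic_of_conj_norm_neg_one
    (by exact_mod_cast Literature.RingTheory.CentralSimple.forall_isUnit_quaternionAlgebra_neg_one_three) (by norm_num)
    (by norm_num) (x := ⟨0, 2, 0, 1⟩) (y := ⟨0, 4, 2, -1⟩) rfl (by rw [norm_w3_vectors.1]; norm_num)
    norm_neg_one_units.2.2.1 norm_neg_one_units.1 norm_neg_one_conj_examples.1 tauK_im_pos im_w3_tauK_pos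
    moebius_rho_tauK moebius_rho_w3_tauK

/-- **`(A(i√(2 − √3)), ρ) ≇ (A(w₃ i√(2 − √3)), ρ)`** (norm-`−1` obstruction with `ε₂`). [cite: KudlaRapoportYang2006, §3.4 Lemma 3.4.3 and §3.2 Prop. 3.2.1] [cite: Lang1982AbelianFunctions, Ch. IX §5 Thm. 5.1] -/
theorem not_isRhoIsomorphic_axis_w3 : ¬ IsRhoIsomorphic (a := -1) (b := 3) (by norm_num) (by norm_num) (ofReal_mul_I_im_ne_zero sqrt_two_sub_sqrt_three_pos.ne') im_w3_axis_pos.ne' :=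
  not_isRhoIsomorphic_of_conj_norm_neg_one
    (by exact_mod_cast Literature.RingTheory.CentralSimple.forall_isUnit_quaternionAlgebra_neg_one_three) (by norm_num)
    (by norm_num) (x := ⟨0, 3, 0, 1⟩) (y := ⟨0, 9, 4, -3⟩) rfl (by rw [norm_w3_vectors.2.1]; norm_num)
    norm_neg_one_units.2.2.2 norm_neg_one_units.2.1 norm_neg_one_conj_examples.2.1 im_axis_pos im_w3_axis_pos
    moebius_rho_three_i_add_ij_axis moebius_rho_w3_axis

/-- **`(A(τ₆″), ρ) ≇ (A(w₃τ₆″), ρ)`** (norm-`−1` obstruction with `ε₁`). [cite: KudlaRapoportYang2006, §3.4 Lemma 3.4.3 and §3.2 Prop. 3.2.1] [cite: Lang1982AbelianFunctions, Ch. IX §5 Thm. 5.1] -/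
theorem not_isRhoIsomorphic_tauSixBis_w3 : ¬ IsRhoIsomorphic (a := -1) (b := 3) (by norm_num) (by norm_num) tauSixBis_im_ne_zero im_w3_tauSixBis_pos.ne' :=
  not_isRhoIsomorphic_of_conj_norm_neg_one
    (by exact_mod_cast Literature.RingTheory.CentralSimple.forall_isUnit_quaternionAlgebra_neg_one_three) (by norm_num)
    (by norm_num) (x := ⟨0, 6, 1, 3⟩) (y := ⟨0, 18, 9, -5⟩) rfl (by rw [norm_w3_vectors.2.2]; norm_num)
    norm_neg_one_units.2.2.1 norm_neg_one_units.1 norm_neg_one_conj_examples.2.2 tauSixBis_im_pos im_w3_tauSixBis_pos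
    moebius_rho_tauSixBis moebius_rho_w3_tauSixBis

end Transports

/-! ## §2 `Z(1)`: six pairwise `Γ`-inequivalent CM points -/

section ZOne

/-- **SIX PAIRWISE `Γ`-INEQUIVALENT POINTS OF `Z(1)`: `i`, `τ_h = (√3 + i)/2`, `τ_k = (2 − √3)i`, `w₃(i)`, `w₃(τ_h)`,
`w₃(τ_k)`** (special vectors `i, 2i + j, 2i + ij, 5i + 2j − 2ij, 16i + 7j − 6ij, 4i + 2j − ij ∈ L(1)`): the 15 QM
surfaces-pairs are non-isomorphic — across classes mod `2𝔬` by an odd coordinate (g29-#3), inside a class by the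
norm-`−1` obstruction (g29-#6). Hence `#(L(1) mod ±Γ) ≥ 6` for Lang's order. [cite: KudlaRapoportYang2006, §3.4 (3.4.13)–(3.4.14), Lemma 3.4.3 and §3.2 Prop. 3.2.1] [cite: Lang1982AbelianFunctions, Ch. IX §5 Thm. 5.1] [cite: Ogg1983RealPoints, §2 p. 283] -/
theorem zOne_six_points :
    ¬ IsRhoIsomorphic (a := -1) (b := 3) (by norm_num) (by norm_num) im_I_ne_zero' tauHex_im_ne_zero ∧
    ¬ IsRhoIsomorphic (a := -1) (b := 3) (by norm_num) (by norm_num) im_I_ne_zero' tauK_im_ne_zero ∧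
    ¬ IsRhoIsomorphic (a := -1) (b := 3) (by norm_num) (by norm_num) im_I_ne_zero' im_w3_I_pos.ne' ∧
    ¬ IsRhoIsomorphic (a := -1) (b := 3) (by norm_num) (by norm_num) im_I_ne_zero' im_w3_tauHex_pos.ne' ∧
    ¬ IsRhoIsomorphic (a := -1) (b := 3) (by norm_num) (by norm_num) im_I_ne_zero' im_w3_tauK_pos.ne' ∧
    ¬ IsRhoIsomorphic (a := -1) (b := 3) (by norm_num) (by norm_num) tauHex_im_ne_zero tauK_im_ne_zero ∧
    ¬ IsRhoIsomorphic (a := -1) (b := 3) (by norm_num) (by norm_num) tauHex_im_ne_zero im_w3_I_pos.ne' ∧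
    ¬ IsRhoIsomorphic (a := -1) (b := 3) (by norm_num) (by norm_num) tauHex_im_ne_zero im_w3_tauHex_pos.ne' ∧
    ¬ IsRhoIsomorphic (a := -1) (b := 3) (by norm_num) (by norm_num) tauHex_im_ne_zero im_w3_tauK_pos.ne' ∧
    ¬ IsRhoIsomorphic (a := -1) (b := 3) (by norm_num) (by norm_num) tauK_im_ne_zero im_w3_I_pos.ne' ∧
    ¬ IsRhoIsomorphic (a := -1) (b := 3) (by norm_num) (by norm_num) tauK_im_ne_zero im_w3_tauHex_pos.ne' ∧
    ¬ IsRhoIsomorphic (a := -1) (b := 3) (by norm_num) (by norm_num) tauK_im_ne_zero im_w3_tauK_pos.ne' ∧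
    ¬ IsRhoIsomorphic (a := -1) (b := 3) (by norm_num) (by norm_num) im_w3_I_pos.ne' im_w3_tauHex_pos.ne' ∧
    ¬ IsRhoIsomorphic (a := -1) (b := 3) (by norm_num) (by norm_num) im_w3_I_pos.ne' im_w3_tauK_pos.ne' ∧
    ¬ IsRhoIsomorphic (a := -1) (b := 3) (by norm_num) (by norm_num) im_w3_tauHex_pos.ne' im_w3_tauK_pos.ne' :=
  ⟨not_isRhoIsomorphic_I_tauHex,
    not_isRhoIsomorphic_I_tauK,
    not_isRhoIsomorphic_I_w3,
  not_isRhoIsomorphic_of_odd_coord (a := -1) (b := 3) (by norm_num) (by norm_num) (x := ⟨0, 1, 0, 0⟩)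
      (y := ⟨0, 16, 7, -6⟩) specialCycle_one_neg_one_three.1 rfl (by intro h; simpa using congrArg QuaternionAlgebra.imI h) rfl
      (by rw [norm_ad_three_examples.2.1, norm_specialVectors_one.1]) (m := ![0, 15, 7, -6])
      (by rw [QuaternionAlgebra.mk_sub_mk]; ext <;> simp [ofCoords]; norm_num) (k := 1) (by decide)
      im_I_ne_zero' im_w3_tauHex_pos.ne' moebius_rho_i_I moebius_rho_w3_tauHex,
  not_isRhoIsomorphic_of_odd_coord (a := -1) (b := 3) (by norm_num) (by norm_num) (x := ⟨0, 1, 0, 0⟩)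
      (y := ⟨0, 4, 2, -1⟩) specialCycle_one_neg_one_three.1 rfl (by intro h; simpa using congrArg QuaternionAlgebra.imI h) rfl
      (by rw [norm_w3_vectors.1, norm_specialVectors_one.1]) (m := ![0, 3, 2, -1])
      (by rw [QuaternionAlgebra.mk_sub_mk]; ext <;> simp [ofCoords]; norm_num) (k := 1) (by decide)
      im_I_ne_zero' im_w3_tauK_pos.ne' moebius_rho_i_I moebius_rho_w3_tauK,
    not_isRhoIsomorphic_tauHex_tauK,
    zOne_four_points.2.1,
    not_isRhoIsomorphic_tauHex_w3,
  not_isRhoIsomorphic_of_odd_coord (a := -1) (b := 3) (by norm_num) (by norm_num) (x := ⟨0, 2, 1, 0⟩)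
      (y := ⟨0, 4, 2, -1⟩) two_i_add_j_mem_order rfl (by intro h; simpa using congrArg QuaternionAlgebra.imI h) rfl
      (by rw [norm_w3_vectors.1, norm_specialVectors_one.2.1]) (m := ![0, 2, 1, -1])
      (by rw [QuaternionAlgebra.mk_sub_mk]; ext <;> simp [ofCoords]; all_goals norm_num) (k := 2) (by decide)
      tauHex_im_ne_zero im_w3_tauK_pos.ne' moebius_rho_two_i_add_j_tauHex moebius_rho_w3_tauK,
    zOne_four_points.2.2.1,
  not_isRhoIsomorphic_of_odd_coord (a := -1) (b := 3) (by norm_num) (by norm_num) (x := ⟨0, 2, 0, 1⟩)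
      (y := ⟨0, 16, 7, -6⟩) two_i_add_ij_mem_order rfl (by intro h; simpa using congrArg QuaternionAlgebra.imI h) rfl
      (by rw [norm_ad_three_examples.2.1, norm_specialVectors_one.2.2]) (m := ![0, 14, 7, -7])
      (by rw [QuaternionAlgebra.mk_sub_mk]; ext <;> simp [ofCoords]; all_goals norm_num) (k := 2) (by decide)
      tauK_im_ne_zero im_w3_tauHex_pos.ne' moebius_rho_tauK moebius_rho_w3_tauHex,
    not_isRhoIsomorphic_tauK_w3,
  not_isRhoIsomorphic_of_odd_coord (a := -1) (b := 3) (by norm_num) (by norm_num) (x := ⟨0, 5, 2, -2⟩)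
      (y := ⟨0, 16, 7, -6⟩) mem_order_w3_vectors.1 rfl (by intro h; simpa using congrArg QuaternionAlgebra.imI h) rfl
      (by rw [norm_ad_three_examples.2.1, norm_ad_three_examples.1]) (m := ![0, 11, 5, -4])
      (by rw [QuaternionAlgebra.mk_sub_mk]; ext <;> simp [ofCoords]; all_goals norm_num) (k := 1) (by decide)
      im_w3_I_pos.ne' im_w3_tauHex_pos.ne' moebius_rho_w3_I moebius_rho_w3_tauHex,
  not_isRhoIsomorphic_of_odd_coord (a := -1) (b := 3) (by norm_num) (by norm_num) (x := ⟨0, 5, 2, -2⟩)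
      (y := ⟨0, 4, 2, -1⟩) mem_order_w3_vectors.1 rfl (by intro h; simpa using congrArg QuaternionAlgebra.imI h) rfl
      (by rw [norm_w3_vectors.1, norm_ad_three_examples.1]) (m := ![0, -1, 0, 1])
      (by rw [QuaternionAlgebra.mk_sub_mk]; ext <;> simp [ofCoords]; all_goals norm_num) (k := 1) (by decide)
      im_w3_I_pos.ne' im_w3_tauK_pos.ne' moebius_rho_w3_I moebius_rho_w3_tauK,
  not_isRhoIsomorphic_of_odd_coord (a := -1) (b := 3) (by norm_num) (by norm_num) (x := ⟨0, 16, 7, -6⟩)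
      (y := ⟨0, 4, 2, -1⟩) mem_order_w3_vectors.2.1 rfl (by intro h; simpa using congrArg QuaternionAlgebra.imI h) rfl
      (by rw [norm_w3_vectors.1, norm_ad_three_examples.2.1]) (m := ![0, -12, -5, 5])
      (by rw [QuaternionAlgebra.mk_sub_mk]; ext <;> simp [ofCoords]; all_goals norm_num) (k := 2) (by decide)
      im_w3_tauHex_pos.ne' im_w3_tauK_pos.ne' moebius_rho_w3_tauHex moebius_rho_w3_tauK⟩

end ZOne

/-! ## §3 `Z(6)`: six pairwise `Γ`-inequivalent CM points -/

section ZSix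

/-- **SIX PAIRWISE `Γ`-INEQUIVALENT POINTS OF `Z(6)`: `τ₆ = (√3 + i√6)/3`, `i√(2 − √3)`, `τ₆″ = (√3 + i√6)/(6 + 3√3)`,
`w₃(τ₆)`, `w₃(i√(2 − √3))`, `w₃(τ₆″)`** (special vectors `3i + j, 3i + ij, 6i + j + 3ij, 21i + 9j − 8ij, 9i + 4j − 3ij,
18i + 9j − 5ij ∈ L(6)`); the first three have `A ≅ (ℂ/ℤ[√−6])²` (g29-#3). Hence `#(L(6) mod ±Γ) ≥ 6`.
[cite: KudlaRapoportYang2006, §3.4 (3.4.13)–(3.4.14), Lemma 3.4.3 and §3.2 Prop. 3.2.1] [cite: Lang1982AbelianFunctions, Ch. IX §5 Thm. 5.1] [cite: Ogg1983RealPoints, §2 p. 283] -/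
theorem zSix_six_points :
    ¬ IsRhoIsomorphic (a := -1) (b := 3) (by norm_num) (by norm_num) tauSix_im_ne_zero (ofReal_mul_I_im_ne_zero sqrt_two_sub_sqrt_three_pos.ne') ∧
    ¬ IsRhoIsomorphic (a := -1) (b := 3) (by norm_num) (by norm_num) tauSix_im_ne_zero tauSixBis_im_ne_zero ∧
    ¬ IsRhoIsomorphic (a := -1) (b := 3) (by norm_num) (by norm_num) tauSix_im_ne_zero im_w3_tauSix_pos.ne' ∧
    ¬ IsRhoIsomorphic (a := -1) (b := 3) (by norm_num) (by norm_num) tauSix_im_ne_zero im_w3_axis_pos.ne' ∧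
    ¬ IsRhoIsomorphic (a := -1) (b := 3) (by norm_num) (by norm_num) tauSix_im_ne_zero im_w3_tauSixBis_pos.ne' ∧
    ¬ IsRhoIsomorphic (a := -1) (b := 3) (by norm_num) (by norm_num) (ofReal_mul_I_im_ne_zero sqrt_two_sub_sqrt_three_pos.ne') tauSixBis_im_ne_zero ∧
    ¬ IsRhoIsomorphic (a := -1) (b := 3) (by norm_num) (by norm_num) (ofReal_mul_I_im_ne_zero sqrt_two_sub_sqrt_three_pos.ne') im_w3_tauSix_pos.ne' ∧
    ¬ IsRhoIsomorphic (a := -1) (b := 3) (by norm_num) (by norm_num) (ofReal_mul_I_im_ne_zero sqrt_two_sub_sqrt_three_pos.ne') im_w3_axis_pos.ne' ∧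
    ¬ IsRhoIsomorphic (a := -1) (b := 3) (by norm_num) (by norm_num) (ofReal_mul_I_im_ne_zero sqrt_two_sub_sqrt_three_pos.ne') im_w3_tauSixBis_pos.ne' ∧
    ¬ IsRhoIsomorphic (a := -1) (b := 3) (by norm_num) (by norm_num) tauSixBis_im_ne_zero im_w3_tauSix_pos.ne' ∧
    ¬ IsRhoIsomorphic (a := -1) (b := 3) (by norm_num) (by norm_num) tauSixBis_im_ne_zero im_w3_axis_pos.ne' ∧
    ¬ IsRhoIsomorphic (a := -1) (b := 3) (by norm_num) (by norm_num) tauSixBis_im_ne_zero im_w3_tauSixBis_pos.ne' ∧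
    ¬ IsRhoIsomorphic (a := -1) (b := 3) (by norm_num) (by norm_num) im_w3_tauSix_pos.ne' im_w3_axis_pos.ne' ∧
    ¬ IsRhoIsomorphic (a := -1) (b := 3) (by norm_num) (by norm_num) im_w3_tauSix_pos.ne' im_w3_tauSixBis_pos.ne' ∧
    ¬ IsRhoIsomorphic (a := -1) (b := 3) (by norm_num) (by norm_num) im_w3_axis_pos.ne' im_w3_tauSixBis_pos.ne' :=
  ⟨not_isRhoIsomorphic_tauSix_axis,
    not_isRhoIsomorphic_tauSix_tauSixBis,
    not_isRhoIsomorphic_tauSix_w3,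
  not_isRhoIsomorphic_of_odd_coord (a := -1) (b := 3) (by norm_num) (by norm_num) (x := ⟨0, 3, 1, 0⟩)
      (y := ⟨0, 9, 4, -3⟩) three_i_add_j_mem_order rfl (by intro h; simpa using congrArg QuaternionAlgebra.imI h) rfl
      (by rw [norm_w3_vectors.2.1, norm_specialVectors_six.1]) (m := ![0, 6, 3, -3])
      (by rw [QuaternionAlgebra.mk_sub_mk]; ext <;> simp [ofCoords]; all_goals norm_num) (k := 2) (by decide)
      tauSix_im_ne_zero im_w3_axis_pos.ne' moebius_rho_tauSix moebius_rho_w3_axis,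
  not_isRhoIsomorphic_of_odd_coord (a := -1) (b := 3) (by norm_num) (by norm_num) (x := ⟨0, 3, 1, 0⟩)
      (y := ⟨0, 18, 9, -5⟩) three_i_add_j_mem_order rfl (by intro h; simpa using congrArg QuaternionAlgebra.imI h) rfl
      (by rw [norm_w3_vectors.2.2, norm_specialVectors_six.1]) (m := ![0, 15, 8, -5])
      (by rw [QuaternionAlgebra.mk_sub_mk]; ext <;> simp [ofCoords]; all_goals norm_num) (k := 1) (by decide)
      tauSix_im_ne_zero im_w3_tauSixBis_pos.ne' moebius_rho_tauSix moebius_rho_w3_tauSixBis,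
    not_isRhoIsomorphic_axis_tauSixBis,
  not_isRhoIsomorphic_of_odd_coord (a := -1) (b := 3) (by norm_num) (by norm_num) (x := ⟨0, 3, 0, 1⟩)
      (y := ⟨0, 21, 9, -8⟩) three_i_add_ij_mem_order rfl (by intro h; simpa using congrArg QuaternionAlgebra.imI h) rfl
      (by rw [norm_ad_three_examples.2.2, norm_specialVectors_six.2.1]) (m := ![0, 18, 9, -9])
      (by rw [QuaternionAlgebra.mk_sub_mk]; ext <;> simp [ofCoords]; all_goals norm_num) (k := 2) (by decide)
      (ofReal_mul_I_im_ne_zero sqrt_two_sub_sqrt_three_pos.ne') im_w3_tauSix_pos.ne' moebius_rho_three_i_add_ij_axis moebius_rho_w3_tauSix,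
    not_isRhoIsomorphic_axis_w3,
  not_isRhoIsomorphic_of_odd_coord (a := -1) (b := 3) (by norm_num) (by norm_num) (x := ⟨0, 3, 0, 1⟩)
      (y := ⟨0, 18, 9, -5⟩) three_i_add_ij_mem_order rfl (by intro h; simpa using congrArg QuaternionAlgebra.imI h) rfl
      (by rw [norm_w3_vectors.2.2, norm_specialVectors_six.2.1]) (m := ![0, 15, 9, -6])
      (by rw [QuaternionAlgebra.mk_sub_mk]; ext <;> simp [ofCoords]; all_goals norm_num) (k := 1) (by decide)
      (ofReal_mul_I_im_ne_zero sqrt_two_sub_sqrt_three_pos.ne') im_w3_tauSixBis_pos.ne' moebius_rho_three_i_add_ij_axis moebius_rho_w3_tauSixBis,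
  not_isRhoIsomorphic_of_odd_coord (a := -1) (b := 3) (by norm_num) (by norm_num) (x := ⟨0, 6, 1, 3⟩)
      (y := ⟨0, 21, 9, -8⟩) six_i_add_j_add_three_ij_mem_order rfl (by intro h; simpa using congrArg QuaternionAlgebra.imI h) rfl
      (by rw [norm_ad_three_examples.2.2, norm_specialVectors_six.2.2]) (m := ![0, 15, 8, -11])
      (by rw [QuaternionAlgebra.mk_sub_mk]; ext <;> simp [ofCoords]; all_goals norm_num) (k := 1) (by decide)
      tauSixBis_im_ne_zero im_w3_tauSix_pos.ne' moebius_rho_tauSixBis moebius_rho_w3_tauSix,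
  not_isRhoIsomorphic_of_odd_coord (a := -1) (b := 3) (by norm_num) (by norm_num) (x := ⟨0, 6, 1, 3⟩)
      (y := ⟨0, 9, 4, -3⟩) six_i_add_j_add_three_ij_mem_order rfl (by intro h; simpa using congrArg QuaternionAlgebra.imI h) rfl
      (by rw [norm_w3_vectors.2.1, norm_specialVectors_six.2.2]) (m := ![0, 3, 3, -6])
      (by rw [QuaternionAlgebra.mk_sub_mk]; ext <;> simp [ofCoords]; all_goals norm_num) (k := 1) (by decide)
      tauSixBis_im_ne_zero im_w3_axis_pos.ne' moebius_rho_tauSixBis moebius_rho_w3_axis,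
    not_isRhoIsomorphic_tauSixBis_w3,
  not_isRhoIsomorphic_of_odd_coord (a := -1) (b := 3) (by norm_num) (by norm_num) (x := ⟨0, 21, 9, -8⟩)
      (y := ⟨0, 9, 4, -3⟩) mem_order_w3_vectors.2.2.1 rfl (by intro h; simpa using congrArg QuaternionAlgebra.imI h) rfl
      (by rw [norm_w3_vectors.2.1, norm_ad_three_examples.2.2]) (m := ![0, -12, -5, 5])
      (by rw [QuaternionAlgebra.mk_sub_mk]; ext <;> simp [ofCoords]; all_goals norm_num) (k := 2) (by decide)
      im_w3_tauSix_pos.ne' im_w3_axis_pos.ne' moebius_rho_w3_tauSix moebius_rho_w3_axis,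
  not_isRhoIsomorphic_of_odd_coord (a := -1) (b := 3) (by norm_num) (by norm_num) (x := ⟨0, 21, 9, -8⟩)
      (y := ⟨0, 18, 9, -5⟩) mem_order_w3_vectors.2.2.1 rfl (by intro h; simpa using congrArg QuaternionAlgebra.imI h) rfl
      (by rw [norm_w3_vectors.2.2, norm_ad_three_examples.2.2]) (m := ![0, -3, 0, 3])
      (by rw [QuaternionAlgebra.mk_sub_mk]; ext <;> simp [ofCoords]; all_goals norm_num) (k := 1) (by decide)
      im_w3_tauSix_pos.ne' im_w3_tauSixBis_pos.ne' moebius_rho_w3_tauSix moebius_rho_w3_tauSixBis,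
  not_isRhoIsomorphic_of_odd_coord (a := -1) (b := 3) (by norm_num) (by norm_num) (x := ⟨0, 9, 4, -3⟩)
      (y := ⟨0, 18, 9, -5⟩) mem_order_w3_vectors.2.2.2 rfl (by intro h; simpa using congrArg QuaternionAlgebra.imI h) rfl
      (by rw [norm_w3_vectors.2.2, norm_w3_vectors.2.1]) (m := ![0, 9, 5, -2])
      (by rw [QuaternionAlgebra.mk_sub_mk]; ext <;> simp [ofCoords]; all_goals norm_num) (k := 1) (by decide)
      im_w3_axis_pos.ne' im_w3_tauSixBis_pos.ne' moebius_rho_w3_axis moebius_rho_w3_tauSixBis⟩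

end ZSix

end Literature.Geometry.Kaehler.ComplexTorus.QuaternionType
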